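import Summits.QuantumAdvantage.QuantumAdvantage.Theorems.RigidityLawsB

/-! # RigidityLaws — part 3/3 (mechanical split for landing of `RigidityLaws`; content verbatim; scopes re-opened with their variables) -/


namespace Summit.QuantumAdvantage.AdviceFreeQNC0.RigidityLaws
open Classical
open Finset
open Summit.QuantumAdvantage.AdviceFreeQNC0
open Literature.Computability.MetaComplexity Literature.Computability.MetaComplexity.Smolensky
variable {n : ℕ}

/-- and near-perfect ⊕ near-null stays near-perfect (`#WIN(y) ≤ #WIN(y ⊕ z) + #WIN(z)`). -/
theorem card_win_le_xorStrat_add (c : ℕ) (y z : Fin (n + 1) → (Fin n → Bool) → Bool) :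
    (univ.filter fun u : Fin n → Bool => ringWinU c y u = true).card ≤
      (univ.filter fun u : Fin n → Bool => ringWinU c (xorStrat y z) u = true).card +
        (univ.filter fun u : Fin n → Bool => ringWinU c z u = true).card := by
  calc (univ.filter fun u : Fin n → Bool => ringWinU c y u = true).card
      ≤ ((univ.filter fun u : Fin n → Bool => ringWinU c (xorStrat y z) u = true) ∪
          (univ.filter fun u : Fin n → Bool => ringWinU c z u = true)).card := by
        apply Finset.card_le_card
        intro u hu
        simp only [Finset.mem_filter, Finset.mem_univ, true_and, Finset.mem_union] at hu ⊢
        rw [ringWinU_xorStrat, hu]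
        cases ringWinU c z u <;> simp
    _ ≤ _ := Finset.card_union_le _ _

/-- Klein-four law, different classes: RIGID_k(y) ∧ RIGID_{k+1}(y') ⇒ RIGID_{k+2}(y ⊕ y'). -/
theorem rigid_xorStrat_of_ne (k : ℕ) (y y' : Fin (n + 1) → (Fin n → Bool) → Bool) (u : Fin n → Bool)
    (hy : ringWinU (k + 1) y u = true ∧ ringWinU (k + 2) y u = true)
    (hy' : ringWinU (k + 2) y' u = true ∧ ringWinU (k + 3) y' u = true) :
    ringWinU (k + 3) (xorStrat y y') u = true ∧ ringWinU (k + 4) (xorStrat y y') u = true := by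
  rw [ringWinU_congr_mod (k + 3) k (by omega) (xorStrat y y') u,
    ringWinU_congr_mod (k + 4) (k + 1) (by omega) (xorStrat y y') u,
    ringWinU_xorStrat, ringWinU_xorStrat]
  have hk : ringWinU k y u = false := lose_of_rigid k y u hy.1 hy.2
  have hky' : ringWinU k y' u = true := by
    rw [ringWinU_congr_mod k (k + 3) (by omega) y' u]; exact hy'.2
  have hk' : ringWinU (k + 1) y' u = false :=
    lose_of_rigid (k + 1) y' u hy'.1 (by rw [ringWinU_congr_mod (k + 1 + 2) (k + 3) (by omega) y' u]; exact hy'.2)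
  rw [hk, hky', hy.1, hk']
  decide

/-- Klein-four law, equal classes: RIGID_k(y) ∧ RIGID_k(y') ⇒ `y ⊕ y'` is DEAD on `u` (loses at `k, k+1, k+2`). -/
theorem dead_xorStrat_of_eq (k : ℕ) (y y' : Fin (n + 1) → (Fin n → Bool) → Bool) (u : Fin n → Bool)
    (hy : ringWinU (k + 1) y u = true ∧ ringWinU (k + 2) y u = true)
    (hy' : ringWinU (k + 1) y' u = true ∧ ringWinU (k + 2) y' u = true) :
    ringWinU k (xorStrat y y') u = false ∧ ringWinU (k + 1) (xorStrat y y') u = false ∧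
      ringWinU (k + 2) (xorStrat y y') u = false := by
  rw [ringWinU_xorStrat, ringWinU_xorStrat, ringWinU_xorStrat, lose_of_rigid k y u hy.1 hy.2,
    lose_of_rigid k y' u hy'.1 hy'.2, hy.1, hy.2, hy'.1, hy'.2]
  decide

/-! ## §7 Calibration `p = 3`: the COMPUTE level is perfectly easy over `𝔽₃` (like the AVOID level)

At `p = 3` the hidden residue `wt u (mod 3)` is a degree-1 form, and the strategy on cuts `{0, 1}`
`y₁ = [(k + wt u) % 3 ≠ 0]`, `y₀ = [(k + wt u) % 3 = 0] ∨ [(k + 2 + wt u + 2[u₀]) % 3 = 0]` (both of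
`𝔽₃`-degree `2`) is RIGID at `k` on EVERY input: register `e₀` when the target class `-(k + wt u)` is `0`,
`e_{W₁}` when `W₁ = 1 + [u₀]` is the target class, and `e₀ + e_{W₁}` (odd-one-out = the third class) when
`W₁` is minus the target class.  Hence the two-charge bound fails at `p = 3` (`not_rigid_hard_three`), mirroring the landed `not_walkHardF_three`. -/

/-- `W_1(u) = [u₀]`. -/
theorem wtPrefix_one (hn : 1 ≤ n) (u : Fin n → Bool) :
    wtPrefix u 1 = if u ⟨0, hn⟩ = true then 1 else 0 := by
  unfold wtPrefix
  by_cases h : u ⟨0, hn⟩ = true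
  · rw [if_pos h]
    have hs : (univ.filter fun i : Fin n => i.val < 1 ∧ u i = true) = {⟨0, hn⟩} := by
      ext i
      simp only [mem_filter, mem_univ, true_and, mem_singleton]
      constructor
      · rintro ⟨hi, -⟩
        exact Fin.ext (show i.val = 0 by omega)
      · intro hi
        subst hi
        exact ⟨by show 0 < 1; omega, h⟩
    rw [hs, card_singleton]
  · rw [if_neg h]
    have hs : (univ.filter fun i : Fin n => i.val < 1 ∧ u i = true) = ∅ := by
      ext i
      simp only [mem_filter, mem_univ, true_and]
      constructor
      · rintro ⟨hi, hui⟩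
        have hi0 : i = ⟨0, hn⟩ := Fin.ext (show i.val = 0 by omega)
        subst hi0
        exact absurd hui h
      · intro hi
        simp at hi
    rw [hs, card_empty]

/-- the walk exponent at cut `1`. -/
theorem walkExp_one (u : Fin n → Bool) : walkExp u 1 = wt u + wtPrefix u 1 := rfl

/-- evaluation of `ringWinU` for a strategy supported on the cuts `{0, 1}`: it wins iff exactly one of the
two cuts is fired and live. -/
theorem ringWinU_pair_iff (hn : 1 ≤ n) (y : Fin (n + 1) → (Fin n → Bool) → Bool)
    (hy : ∀ g : Fin (n + 1), 2 ≤ g.val → ∀ u, y g u = false) (a : ℕ) (u : Fin n → Bool) :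
    ringWinU a y u = true ↔
      (((y 0 u = true ∧ (a + wt u) % 3 ≠ 0) ∧
          ¬ (y ⟨1, by omega⟩ u = true ∧ (a + 1 + (wt u + wtPrefix u 1)) % 3 ≠ 0)) ∨
        (¬ (y 0 u = true ∧ (a + wt u) % 3 ≠ 0) ∧
          (y ⟨1, by omega⟩ u = true ∧ (a + 1 + (wt u + wtPrefix u 1)) % 3 ≠ 0))) := by
  unfold ringWinU
  rw [decide_eq_true_iff]
  have h01 : (0 : Fin (n + 1)) ∉ ({⟨1, by omega⟩} : Finset (Fin (n + 1))) := by
    simp [Fin.ext_iff]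
  have hsub : (univ.filter fun g : Fin (n + 1) =>
      y g u = true ∧ (a + g.val + walkExp u g.val) % 3 ≠ 0) =
        ({(0 : Fin (n + 1)), ⟨1, by omega⟩} : Finset (Fin (n + 1))).filter
          fun g => y g u = true ∧ (a + g.val + walkExp u g.val) % 3 ≠ 0 := by
    ext g
    simp only [mem_filter, mem_univ, true_and, mem_insert, mem_singleton]
    constructor
    · rintro ⟨hyg, hl⟩
      refine ⟨?_, hyg, hl⟩
      rcases Nat.lt_or_ge g.val 2 with hlt | hge
      · rcases (show g.val = 0 ∨ g.val = 1 by omega) with h | h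
        · exact Or.inl (Fin.ext (by rw [h]; simp))
        · exact Or.inr (Fin.ext h)
      · rw [hy g hge u] at hyg
        exact absurd hyg Bool.false_ne_true
    · rintro ⟨-, hyg, hl⟩
      exact ⟨hyg, hl⟩
  rw [hsub, Finset.filter_insert, Finset.filter_singleton]
  simp only [Fin.val_zero, add_zero, walkExp_zero, walkExp_one]
  by_cases hy0 : y 0 u = true <;> by_cases hy1 : y ⟨1, by omega⟩ u = true <;>
    by_cases hl0 : (a + wt u) % 3 = 0 <;> by_cases hl1 : (a + 1 + (wt u + wtPrefix u 1)) % 3 = 0 <;>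
    simp [hy0, hy1, hl0, hl1, h01]

/-- the `𝔽₃` rigid strategy on the cuts `{0, 1}`. -/
def rigidThree (k : ℕ) (hn : 1 ≤ n) : Fin (n + 1) → (Fin n → Bool) → Bool := fun g u =>
  if g.val = 0 then
    decide ((k + wt u) % 3 = 0 ∨ (k + 2 + wt u + 2 * (if u ⟨0, hn⟩ = true then 1 else 0)) % 3 = 0)
  else if g.val = 1 then decide ((k + wt u) % 3 ≠ 0) else false

/-- `rigidThree` fires no cut `g ≥ 2`. -/
theorem rigidThree_tail (k : ℕ) (hn : 1 ≤ n) (g : Fin (n + 1)) (hg : 2 ≤ g.val) (u : Fin n → Bool) :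
    rigidThree k hn g u = false := by
  unfold rigidThree
  rw [if_neg (by omega), if_neg (by omega)]

/-- `rigidThree` at cut `0`. -/
theorem rigidThree_at_zero (k : ℕ) (hn : 1 ≤ n) (u : Fin n → Bool) :
    rigidThree k hn 0 u =
      decide ((k + wt u) % 3 = 0 ∨ (k + 2 + wt u + 2 * (if u ⟨0, hn⟩ = true then 1 else 0)) % 3 = 0) := by
  simp [rigidThree]

/-- `rigidThree` at cut `1`. -/
theorem rigidThree_at_one (k : ℕ) (hn : 1 ≤ n) (u : Fin n → Bool) (h1 : 1 < n + 1) :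
    rigidThree k hn ⟨1, h1⟩ u = decide ((k + wt u) % 3 ≠ 0) := by
  simp [rigidThree]

/-- the `𝔽₃` strategy wins at every charge `≢ k`, on EVERY input. -/
theorem rigidThree_wins (k : ℕ) (hn : 1 ≤ n) (u : Fin n → Bool) (a : ℕ)
    (ha : a % 3 = (k + 1) % 3 ∨ a % 3 = (k + 2) % 3) : ringWinU a (rigidThree k hn) u = true := by
  rw [ringWinU_pair_iff hn (rigidThree k hn) (rigidThree_tail k hn) a u, rigidThree_at_zero,
    rigidThree_at_one, wtPrefix_one hn]
  simp only [decide_eq_true_eq]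
  by_cases hu : u ⟨0, hn⟩ = true
  · simp only [hu, ite_true]
    omega
  · simp only [hu, Bool.false_eq_true, ite_false]
    omega

/-- the linear form `u ↦ c + wt u` (any field). -/
def linForm (F : Type*) [Field F] (c : ℕ) : CubeFn F n := fun u => ((c + wt u : ℕ) : F)

/-- it has degree `≤ 1`. -/
theorem linForm_mem_lowDeg (F : Type*) [Field F] (c : ℕ) : linForm F c ∈ lowDeg F n 1 := by
  have heq : (linForm F c : CubeFn F n) = (c : F) • (1 : CubeFn F n) + ∑ i : Fin n, mono F {i} := by
    funext u
    simp only [linForm, Pi.add_apply, Pi.smul_apply, Pi.one_apply, smul_eq_mul, mul_one, Finset.sum_apply,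
      mono_apply, Finset.mem_singleton, forall_eq, Nat.cast_add]
    congr 1
    unfold wt
    rw [Finset.card_filter]
    push_cast
    rfl
  rw [heq]
  refine Submodule.add_mem _ (Submodule.smul_mem _ _ (one_mem_lowDeg 1)) ?_
  exact Submodule.sum_mem _ fun i _ => mono_mem_lowDeg (by simp)

/-- the form `u ↦ k + 2 + wt u + 2[u₀]` over `𝔽₃`. -/
def linFormB (k : ℕ) (hn : 1 ≤ n) : CubeFn (ZMod 3) n :=
  fun u => ((k + 2 + wt u + 2 * (if u ⟨0, hn⟩ = true then 1 else 0) : ℕ) : ZMod 3)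

/-- it has degree `≤ 1`. -/
theorem linFormB_mem_lowDeg (k : ℕ) (hn : 1 ≤ n) : linFormB k hn ∈ lowDeg (ZMod 3) n 1 := by
  have heq : linFormB k hn = linForm (ZMod 3) (k + 2) + (2 : ZMod 3) • mono (ZMod 3) {(⟨0, hn⟩ : Fin n)} := by
    funext u
    simp only [linFormB, linForm, Pi.add_apply, Pi.smul_apply, smul_eq_mul, mono_apply,
      Finset.mem_singleton, forall_eq]
    push_cast
    all_goals ring
  rw [heq]
  exact Submodule.add_mem _ (linForm_mem_lowDeg (ZMod 3) (k + 2))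
    (Submodule.smul_mem _ _ (mono_mem_lowDeg (by simp)))

/-- in `𝔽₃`: `m² = [m % 3 ≠ 0]`. -/
theorem natCast_sq_zmod_three (m : ℕ) : ((m : ℕ) : ZMod 3) ^ 2 = if m % 3 ≠ 0 then 1 else 0 := by
  by_cases h : m % 3 ≠ 0
  · rw [if_pos h]
    have hne : ((m : ℕ) : ZMod 3) ≠ 0 := by
      rw [Ne, ZMod.natCast_eq_zero_iff]
      rintro ⟨k, hk⟩
      omega
    exact ZMod.pow_card_sub_one_eq_one hne
  · rw [if_neg h]
    rw [not_not] at h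
    have h0 : ((m : ℕ) : ZMod 3) = 0 := by
      rw [ZMod.natCast_eq_zero_iff]
      exact Nat.dvd_of_mod_eq_zero h
    rw [h0]
    norm_num

/-- both components of the `𝔽₃` strategy have degree `≤ 2`:
`[y₁] = A²`, `[y₀] = (1 - A²) + (1 - B²)` with `A = k + wt u`, `B = k + 2 + wt u + 2[u₀]`. -/
theorem rigidThree_deg (k : ℕ) (hn : 1 ≤ n) (g : Fin (n + 1)) : HasDegF 3 (rigidThree k hn g) 2 := by
  unfold HasDegF
  have hA := linForm_mem_lowDeg (ZMod 3) (n := n) k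
  have hB := linFormB_mem_lowDeg k hn
  have hA2 : linForm (ZMod 3) k * linForm (ZMod 3) k ∈ lowDeg (ZMod 3) n 2 := by
    simpa using mul_mem_lowDeg_add hA hA
  have hB2 : linFormB k hn * linFormB k hn ∈ lowDeg (ZMod 3) n 2 := by
    simpa using mul_mem_lowDeg_add hB hB
  by_cases hg0 : g.val = 0
  · have heq : (fun u : Fin n → Bool => if rigidThree k hn g u = true then (1 : ZMod 3) else 0) =
        ((1 : CubeFn (ZMod 3) n) - linForm (ZMod 3) k * linForm (ZMod 3) k) +
          ((1 : CubeFn (ZMod 3) n) - linFormB k hn * linFormB k hn) := by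
      funext u
      have hval : (linForm (ZMod 3) k * linForm (ZMod 3) k : CubeFn (ZMod 3) n) u =
          if (k + wt u) % 3 ≠ 0 then 1 else 0 := by
        rw [Pi.mul_apply, ← sq]; exact natCast_sq_zmod_three _
      have hvalB : ((linFormB k hn * linFormB k hn) u : ZMod 3) =
          if (k + 2 + wt u + 2 * (if u ⟨0, hn⟩ = true then 1 else 0)) % 3 ≠ 0 then 1 else 0 := by
        rw [Pi.mul_apply, ← sq]; exact natCast_sq_zmod_three _
      rw [Pi.add_apply, Pi.sub_apply, Pi.sub_apply, Pi.one_apply, hval, hvalB]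
      simp only [rigidThree, hg0, ite_true, decide_eq_true_eq]
      by_cases hu : u ⟨0, hn⟩ = true
      · simp only [hu, ite_true, mul_one]
        by_cases h1 : (k + wt u) % 3 = 0 <;> by_cases h2 : (k + 2 + wt u + 2) % 3 = 0
        · exfalso
          omega
        · rw [if_pos (Or.inl h1), if_neg (fun h => h h1), if_pos h2]
          ring
        · rw [if_pos (Or.inr h2), if_pos h1, if_neg (fun h => h h2)]
          ring
        · rw [if_neg (by rintro (h | h) <;> omega), if_pos h1, if_pos h2]
          ring
      · simp only [hu, Bool.false_eq_true, ite_false, mul_zero, add_zero]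
        by_cases h1 : (k + wt u) % 3 = 0 <;> by_cases h2 : (k + 2 + wt u) % 3 = 0
        · exfalso
          omega
        · rw [if_pos (Or.inl h1), if_neg (fun h => h h1), if_pos h2]
          ring
        · rw [if_pos (Or.inr h2), if_pos h1, if_neg (fun h => h h2)]
          ring
        · rw [if_neg (by rintro (h | h) <;> omega), if_pos h1, if_pos h2]
          ring
    rw [heq]
    exact Submodule.add_mem _ (Submodule.sub_mem _ (one_mem_lowDeg 2) hA2)
      (Submodule.sub_mem _ (one_mem_lowDeg 2) hB2)
  · by_cases hg1 : g.val = 1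
    · have heq : (fun u : Fin n → Bool => if rigidThree k hn g u = true then (1 : ZMod 3) else 0) =
          linForm (ZMod 3) k * linForm (ZMod 3) k := by
        funext u
        have hval : (linForm (ZMod 3) k * linForm (ZMod 3) k : CubeFn (ZMod 3) n) u =
            if (k + wt u) % 3 ≠ 0 then 1 else 0 := by
          rw [Pi.mul_apply, ← sq]; exact natCast_sq_zmod_three _
        rw [hval]
        simp only [rigidThree, hg1, ite_true]
        by_cases h1 : (k + wt u) % 3 = 0 <;> simp [h1]
      rw [heq]
      exact hA2
    · have heq : (fun u : Fin n → Bool => if rigidThree k hn g u = true then (1 : ZMod 3) else 0) = 0 := by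
        funext u
        simp [rigidThree, hg0, hg1]
      rw [heq]
      exact Submodule.zero_mem _

/-- **`RigidEasyThree`**: at `p = 3`, for every `k` and `n ≥ 1`, a strategy of `𝔽₃`-degree `2` is RIGID at `k`
(wins at both charges `k+1`, `k+2`) on EVERY input. -/
theorem rigidEasyThree (k n : ℕ) (hn : 1 ≤ n) :
    ∃ y : Fin (n + 1) → (Fin n → Bool) → Bool, (∀ g, HasDegF 3 (y g) 2) ∧
      ∀ u : Fin n → Bool, ringWinU (k + 1) y u = true ∧ ringWinU (k + 2) y u = true :=
  ⟨rigidThree k hn, rigidThree_deg k hn, fun u =>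
    ⟨rigidThree_wins k hn u (k + 1) (Or.inl rfl), rigidThree_wins k hn u (k + 2) (Or.inr rfl)⟩⟩

/-- **The two-charge bound FAILS at `p = 3`** (like the one-charge bound, `not_walkHardF_three`): no `θ < 1` bounds the
rigid mass of polylog-`𝔽₃`-degree strategies. -/
theorem not_rigid_hard_three :
    ¬ ∃ θ : ℝ, θ < 1 ∧ ∀ C : ℕ, ∃ n₀ : ℕ, ∀ n ≥ n₀, ∀ k : ℕ, ∀ y : Fin (n + 1) → (Fin n → Bool) → Bool,
      (∀ g, HasDegF 3 (y g) ((Nat.log 2 n) ^ C)) →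
        ((univ.filter fun u : Fin n → Bool =>
            ringWinU (k + 1) y u = true ∧ ringWinU (k + 2) y u = true).card : ℝ) ≤ θ * (2 : ℝ) ^ n := by
  rintro ⟨θ, hθ, h⟩
  obtain ⟨n₀, hn₀⟩ := h 1
  set n := max n₀ 4 with hn
  obtain ⟨y, hdeg, hwin⟩ := rigidEasyThree 0 n (by omega)
  have hlog : 2 ≤ Nat.log 2 n := Nat.le_log_of_pow_le (by norm_num) (by omega)
  have hdeg' : ∀ g, HasDegF 3 (y g) ((Nat.log 2 n) ^ 1) := fun g =>
    lowDeg_mono (by rw [pow_one]; exact hlog) (hdeg g)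
  have hb := hn₀ n (le_max_left _ _) 0 y hdeg'
  have hall : (univ.filter fun u : Fin n → Bool =>
      ringWinU (0 + 1) y u = true ∧ ringWinU (0 + 2) y u = true) = univ :=
    Finset.filter_true_of_mem fun u _ => hwin u
  rw [hall, card_univ, Fintype.card_fun, Fintype.card_bool, Fintype.card_fin] at hb
  push_cast at hb
  have hpos : (0 : ℝ) < (2 : ℝ) ^ n := by positivity
  nlinarith

end Summit.QuantumAdvantage.AdviceFreeQNC0.RigidityLaws
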